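import Literature.NumberTheory.EllipticCurves.ZpCorankLowerBoundOfTorsionLevels
import HarnessLib

/-!
# P412 in the kernel, III — GROWTH of the finite levels of a `p`-primary group with finite `p`-torsion:
# `p^{e·corank} ≤ #A[p^e]` and `#(A/p^e A)` bounded

Cell `bsd-2adic` (run/shared/lean/pub/bsd-2adic/), seat `bsd-2adic-t42` GEN 20 (pen RC-315 (b): discharge of the PRINT
binder P412 = `Greenberg1999.prop412_noFiniteSubmodule_H1Sigma_of_rank_one`). HONEST FRAMING: research route;
THEOREMS ONLY (no `def`, no named fact, no instance, no `sorry`); nothing booked; BSD is not proved by any of this.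
PARTITION: K4 PRINT binder P412 × all p — reduces-the-named-input-of; bears_on K4 19097
(`--supports stmt-BirchSwinnertonDyer-19097`).

## What (Greenberg LNM 1716 §1: a cofinitely generated `p`-primary group is `(ℚ_p/ℤ_p)^ρ ⊕ (finite)`; §4 p. 114: the
## corank Euler characteristic is read off the growth of `#Hⁱ(F_Σ/F_n, E[p^k])` in `k`)

Pure group theory (no structure theorem), on the tree's `zpCorank A p` and its «stable divisible part»
machinery (`exists_torsionBy_inf_range_stable`, `exists_nsmul_eq_of_stable`, `pow_zpCorank_eq_natCard_torsionBy_inf_range_of_stable`,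
`natCard_torsionBy_pow_eq_pow_of_pDivisible`): for a `p`-primary abelian group `A` with `A[p]` finite and
`ρ = zpCorank A p`,
* `pow_mul_zpCorank_le_natCard_torsionBy_pow` — `p^{e·ρ} ≤ #A[p^e]` for every `e` (the divisible part `D = p^k A`
  has `#D[p^e] = p^{e·ρ}`);
* `exists_natCard_quotient_range_nsmul_pow_le` — ONE constant `f ≥ 1` with `A ⧸ p^e A` finite of order `≤ f` for every
  `e` (`p^e A ⊇ p^e D = D` and `A/D` is finite).
These are the two growth estimates of the corank count `Σ(−1)ⁱ corank_{ℤ_p} Hⁱ(ℚ_Σ/ℚ, E[p^∞]) ≤ −1` (file EulerBase).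

References: [GreenbergLNM1716] §1 (pp. 54–57), §4 p. 114; otherwise [folklore].
-/

set_option autoImplicit false
set_option linter.dupNamespace false

noncomputable section

open scoped Classical AddSubgroup

namespace Summit.BirchSwinnertonDyer.BirchSwinnertonDyer.Theorems.P412Kernel

open Literature.NumberTheory.EllipticCurves

universe u

variable {A : Type u} [AddCommGroup A] (p : ℕ) [Fact p.Prime]

/-- **The divisible part and its invariants** (packaging of the tree's stable-index machinery): for a `p`-primary
`A` with finite `A[p]` there is `k` such that `D = p^k A` is `p`-divisible, `A ⧸ D` is finite and non-trivially counted,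
`D[p]` is finite and `#D[p^e] = p^{e · zpCorank A p}` for every `e`.
[cite: GreenbergLNM1716, §1 (pp. 54–57)] -/
theorem exists_divisible_part (hA : ∀ a : A, ∃ n : ℕ, p ^ n • a = 0) [Finite A[(p : ℤ)]] :
    ∃ k : ℕ, (∀ d : ↥(nsmulAddMonoidHom (α := A) (p ^ k)).range,
        ∃ d' : ↥(nsmulAddMonoidHom (α := A) (p ^ k)).range, p • d' = d) ∧
      Finite (A ⧸ (nsmulAddMonoidHom (α := A) (p ^ k)).range) ∧
      Finite (↥(nsmulAddMonoidHom (α := A) (p ^ k)).range)[(p : ℤ)] ∧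
      ∀ e : ℕ, Nat.card (↥(nsmulAddMonoidHom (α := A) (p ^ k)).range)[((p ^ e : ℕ) : ℤ)] =
        p ^ (e * zpCorank A p) := by
  have hp : p.Prime := Fact.out
  obtain ⟨k, hst⟩ := exists_torsionBy_inf_range_stable (A := A) p
  set Dsub : AddSubgroup A := (nsmulAddMonoidHom (α := A) (p ^ k)).range with hDsub
  have hdiv : ∀ c ∈ Dsub, ∃ c' ∈ Dsub, p • c' = c := fun c hc ↦ by
    obtain ⟨n, hn⟩ := hA c
    exact exists_nsmul_eq_of_stable p hst n c hc hn
  have hDd : ∀ d : Dsub, ∃ d' : Dsub, p • d' = d := fun d ↦ by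
    obtain ⟨d', hd', hpd⟩ := hdiv d d.2
    exact ⟨⟨d', hd'⟩, Subtype.ext hpd⟩
  have hcor := pow_zpCorank_eq_natCard_torsionBy_inf_range_of_stable (A := A) p hA hst
  haveI hfinAD : Finite ↥(A[(p : ℤ)] ⊓ Dsub) :=
    Finite.of_injective (AddSubgroup.inclusion (inf_le_left : A[(p : ℤ)] ⊓ Dsub ≤ A[(p : ℤ)]))
      (AddSubgroup.inclusion_injective _)
  have hDp : Nat.card (↥Dsub)[(p : ℤ)] = Nat.card ↥(A[(p : ℤ)] ⊓ Dsub) := by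
    refine Nat.card_congr (Equiv.ofBijective
      (fun x : (↥Dsub)[(p : ℤ)] ↦ (⟨((x : Dsub) : A), AddSubgroup.mem_inf.mpr ⟨?_, (x : Dsub).2⟩⟩ :
        ↥(A[(p : ℤ)] ⊓ Dsub))) ⟨?_, ?_⟩)
    · rw [AddSubgroup.torsionBy.nsmul_iff, ← AddSubgroupClass.coe_nsmul,
        AddSubgroup.torsionBy.nsmul_iff.mp (x : (↥Dsub)[(p : ℤ)]).2, ZeroMemClass.coe_zero]
    · intro x y hxy
      have h := congrArg Subtype.val hxy
      exact Subtype.ext (Subtype.ext h)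
    · rintro ⟨a, ha⟩
      obtain ⟨ha₁, ha₂⟩ := AddSubgroup.mem_inf.mp ha
      refine ⟨⟨⟨a, ha₂⟩, AddSubgroup.torsionBy.nsmul_iff.mpr (Subtype.ext ?_)⟩, rfl⟩
      rw [AddSubgroupClass.coe_nsmul, ZeroMemClass.coe_zero]
      exact AddSubgroup.torsionBy.nsmul_iff.mp ha₁
  haveI hfinDp : Finite (↥Dsub)[(p : ℤ)] :=
    Nat.finite_of_card_ne_zero (by rw [hDp]; exact Nat.card_pos.ne')
  -- `A/D` is finite: `(A/D)[p]` is the image of `A[p]`, and `p^k (A/D) = 0`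
  have hf : Function.Surjective (QuotientAddGroup.mk' Dsub) := QuotientAddGroup.mk'_surjective Dsub
  have hex : ∀ a, QuotientAddGroup.mk' Dsub a = 0 → a ∈ Dsub.subtype.range := fun a ha ↦ by
    rw [AddSubgroup.range_subtype]; exact (QuotientAddGroup.eq_zero_iff a).mp ha
  have hfi : ∀ d : Dsub, QuotientAddGroup.mk' Dsub (Dsub.subtype d) = 0 := fun d ↦
    (QuotientAddGroup.eq_zero_iff _).mpr d.2
  haveI : Finite (A ⧸ Dsub)[(p : ℤ)] :=
    Finite.of_surjective _ (torsionByMap_surjective (p := p) hf hex hfi hDd)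
  haveI hfinQ : Finite (A ⧸ Dsub) := by
    haveI := finite_torsionBy_pow (A ⧸ Dsub) p k
    refine Finite.of_injective (fun z : A ⧸ Dsub ↦ (⟨z, ?_⟩ : (A ⧸ Dsub)[((p ^ k : ℕ) : ℤ)]))
      (fun z w hzw ↦ congrArg Subtype.val hzw)
    induction z using QuotientAddGroup.induction_on with
    | H a =>
      rw [AddSubgroup.torsionBy.nsmul_iff, ← QuotientAddGroup.mk_nsmul, QuotientAddGroup.eq_zero_iff]
      exact ⟨a, rfl⟩
  refine ⟨k, hDd, hfinQ, hfinDp, fun e ↦ ?_⟩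
  rw [natCard_torsionBy_pow_eq_pow_of_pDivisible p hDd e, hDp, ← hcor, ← pow_mul, mul_comm]

/-- **Lower growth bound `p^{e·ρ} ≤ #A[p^e]`** (`ρ = zpCorank A p`; `A` `p`-primary with `A[p]` finite): the
divisible part `D = p^k A` contributes `D[p^e]` of order exactly `p^{e·ρ}`.
[cite: GreenbergLNM1716, §1 (pp. 54–57)] -/
theorem pow_mul_zpCorank_le_natCard_torsionBy_pow (hA : ∀ a : A, ∃ n : ℕ, p ^ n • a = 0)
    [Finite A[(p : ℤ)]] (e : ℕ) :
    p ^ (e * zpCorank A p) ≤ Nat.card A[((p ^ e : ℕ) : ℤ)] := by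
  obtain ⟨k, _, _, _, hcard⟩ := exists_divisible_part p hA
  haveI : Finite A[((p ^ e : ℕ) : ℤ)] := finite_torsionBy_pow A p e
  rw [← hcard e]
  refine Nat.card_le_card_of_injective
    (fun x : (↥(nsmulAddMonoidHom (α := A) (p ^ k)).range)[((p ^ e : ℕ) : ℤ)] ↦
      (⟨((x : (nsmulAddMonoidHom (α := A) (p ^ k)).range) : A), ?_⟩ : A[((p ^ e : ℕ) : ℤ)])) ?_
  · rw [AddSubgroup.torsionBy.nsmul_iff, ← AddSubgroupClass.coe_nsmul,
      AddSubgroup.torsionBy.nsmul_iff.mp x.2, ZeroMemClass.coe_zero]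
  · intro x y hxy
    have h := congrArg Subtype.val hxy
    exact Subtype.ext (Subtype.ext h)

/-- **Bounded cotorsion `#(A ⧸ p^e A) ≤ f`** for ONE constant `f ≥ 1` and EVERY `e` (`A` `p`-primary with `A[p]` finite):
`p^e A ⊇ p^e · p^k A = p^k A = D` (the divisible part) and `A ⧸ D` is finite; also every `A ⧸ p^e A` is finite.
[cite: GreenbergLNM1716, §1 (pp. 54–57)] -/
theorem exists_natCard_quotient_range_nsmul_pow_le (hA : ∀ a : A, ∃ n : ℕ, p ^ n • a = 0)
    [Finite A[(p : ℤ)]] :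
    ∃ f : ℕ, 0 < f ∧ ∀ e : ℕ, Finite (A ⧸ (nsmulAddMonoidHom (α := A) (p ^ e)).range) ∧
      Nat.card (A ⧸ (nsmulAddMonoidHom (α := A) (p ^ e)).range) ≤ f := by
  obtain ⟨k, hDd, hfinQ, _, _⟩ := exists_divisible_part p hA
  set Dsub : AddSubgroup A := (nsmulAddMonoidHom (α := A) (p ^ k)).range with hDsub
  haveI := hfinQ
  -- `D` is `p^e`-divisible, hence `D ≤ p^e A`
  have hpowdiv : ∀ (e : ℕ) (d : Dsub), ∃ d' : Dsub, p ^ e • d' = d := by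
    intro e
    induction e with
    | zero => exact fun d ↦ ⟨d, by rw [pow_zero, one_smul]⟩
    | succ e ih =>
      intro d
      obtain ⟨d₁, hd₁⟩ := ih d
      obtain ⟨d₂, hd₂⟩ := hDd d₁
      exact ⟨d₂, by rw [pow_succ, mul_smul, hd₂, hd₁]⟩
  have hle : ∀ e : ℕ, Dsub ≤ (nsmulAddMonoidHom (α := A) (p ^ e)).range := fun e d hd ↦ by
    obtain ⟨d', hd'⟩ := hpowdiv e ⟨d, hd⟩
    exact ⟨(d' : A), by rw [nsmulAddMonoidHom_apply, ← AddSubgroupClass.coe_nsmul, hd']⟩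
  refine ⟨Nat.card (A ⧸ Dsub), Nat.card_pos, fun e ↦ ?_⟩
  have hsurj : Function.Surjective
      (QuotientAddGroup.map Dsub (nsmulAddMonoidHom (α := A) (p ^ e)).range (AddMonoidHom.id A) (hle e)) :=
    fun z ↦ by
      induction z using QuotientAddGroup.induction_on with
      | H a => exact ⟨a, rfl⟩
  exact ⟨Finite.of_surjective _ hsurj, Nat.card_le_card_of_surjective _ hsurj⟩

end Summit.BirchSwinnertonDyer.BirchSwinnertonDyer.Theorems.P412Kernel

end
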